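import Summits.AnomalousDissipation.AnomalousDissipation.Theses.ImpulseGrid
import Literature.Analysis.FluidPDE.TimeAverageMeasureExistence

/-!
# Sketch — crux `ImpulseGrid.GridThesis` (stmt-AnomalousDissipation-1770), crux-ideate round 1, ideator 2

Typed first lemmas for two crux idea cards (planner-cruxidea-stmt-AnomalousDissipation-1770-2-0,
2026-08-16). Everything is stated over the LIVE route file (imported) and tree notions; two
abstract cores are PROVED (`eventually_signs_of_workSplit`, `nonneg_of_barrier`), the rest are
`def … : Prop` statements (no `sorry`).

* Card `ac-dc-eddy-drag`: `IsGridDesign`, `IsBoundedNoLeakFamily`, `WorkSplitThesis` (C⁺, the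
  LINEAR form of the crux), `LaplacianPairingBound`, `WorkSplitTransfer`/`WorkSplitOfGridThesis`
  (C⁺ ⇔ crux modulo the provable-now support `GridInjectionIdentity`), the proved real-analysis
  core `eventually_signs_of_workSplit`, the exact modal balance `AlphaBalance` (F2 of NOTES.md),
  `EddyDragThesis` (C⁺⁺) and `EddyDragTransfer`.
* Card `no-reversal-half-space`: `NoReversalBarrier`, `NoReversalOfSubthresholdWake`,
  `SubthresholdWakeThesis` (C⁺), `SubthresholdTransfer`, and the proved abstract barrier lemma
  `nonneg_of_barrier`.
-/

namespace Summit.AnomalousDissipation.AnomalousDissipation.Cruxes.GridThesis.Ideator2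

open MeasureTheory Filter Set
open Summit.AnomalousDissipation.AnomalousDissipation.Theses.ImpulseGrid

noncomputable section

local notation "𝕋³" => UnitAddTorus (Fin 3)
local notation "E³" => EuclideanSpace ℝ (Fin 3)

/-! ### Shared clause blocks (verbatim sub-conjunctions of `GridThesis`) -/

/-- The DESIGN clauses of `GridThesis` (slab profile `Φ`, sawtooth `Ψ`, transverse pattern `G`,
drift `c`), verbatim. -/
def IsGridDesign (Φ Ψ : 𝕋³ → ℝ) (G : 𝕋³ → E³) (c : ℝ) : Prop :=
  Literature.Analysis.FunctionSpaces.Torus.IsSmooth Φ ∧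
  Literature.Analysis.FunctionSpaces.Torus.IsSmooth Ψ ∧
  Literature.Analysis.FunctionSpaces.Torus.IsSmooth G ∧
  (∀ (s : UnitAddCircle) x, Ψ (x + Pi.single (1 : Fin 3) s) = Ψ x ∧ Ψ (x + Pi.single (2 : Fin 3) s) = Ψ x) ∧
  (∀ (s : UnitAddCircle) x, G (x + Pi.single (0 : Fin 3) s) = G x) ∧ (∀ x, G x 0 = 0) ∧
  Literature.Analysis.FunctionSpaces.Torus.IsDivFree G ∧
  (∀ x, Literature.Analysis.FunctionSpaces.Torus.partialDeriv 0 Ψ x = Φ x - 1) ∧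
  (∫ x, Φ x * Ψ x * ‖G x‖ ^ 2 = 0) ∧
  Literature.Analysis.FunctionSpaces.Torus.IsSmooth (fun x => Φ x • G x) ∧
  Literature.Analysis.FunctionSpaces.Torus.IsDivFree (fun x => Φ x • G x) ∧
  Literature.Analysis.FunctionSpaces.Torus.HasZeroMean (fun x => Φ x • G x) ∧ 0 < c

/-- The FAMILY clauses of `GridThesis` minus the two sign conditions: vanishing viscosity, global
Leray–Hopf, per-`j` sup-in-time energy bound, drift data `∫u₀ⱼ = c e₀`, ν-uniformly bounded mean
energy (BE) and no Leray–Hopf leakage in the mean (NL). -/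
def IsBoundedNoLeakFamily (Φ : 𝕋³ → ℝ) (G : 𝕋³ → E³) (c : ℝ) (ν : ℕ → ℝ)
    (u₀ : ℕ → 𝕋³ → E³) (u : ℕ → ℝ → 𝕋³ → E³) : Prop :=
  (∀ j, 0 < ν j) ∧ Tendsto ν atTop (nhds 0) ∧
  (∀ j, Literature.Analysis.FluidPDE.Torus.IsGlobalLerayHopf (ν j) (fun _ => fun x => Φ x • G x) (u₀ j) (u j)) ∧
  (∀ j, ∃ C : ℝ, ∀ t : ℝ, 0 ≤ t → Literature.Analysis.FunctionSpaces.Torus.kineticEnergy (u j t) ≤ C) ∧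
  (∀ j, ∫ x, u₀ j x = c • EuclideanSpace.single (0 : Fin 3) (1 : ℝ)) ∧
  (∃ E : ℝ, ∀ j, Literature.Analysis.FluidPDE.meanEnergy (u j) ≤ E) ∧
  (∀ j, Literature.Analysis.FluidPDE.longTimeAvgSup (fun t => ∫ x, inner ℝ (Φ x • G x) (u j t x)) ≤
    Literature.Analysis.FluidPDE.meanDissipation (ν j) (u j))

/-! ### Card `ac-dc-eddy-drag` — the crux is LINEAR in the mean wake -/

/-- **C⁺ (AC/DC work split).** Same design, same BE+NL family class as `GridThesis`, but the two
sign conditions are replaced by two LINEAR inequalities on the Banach-mean wake: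
(DC) the resonant mean pattern `G` does non-negative work, `0 ≤ Λ⟨(G,uⱼ)⟩` (= clause (a)
verbatim), and (AC) the detuned (swept) part `f − G = (Φ−1)G` of the force does work `≥ η″ > 0`.
By `GridInjectionIdentity`(1) and `∫ΦΨ|G|² = 0`, clause (b) of the crux reads
`Λ⟨∫⟪w,(w·∇)(ΨG)⟫⟩ = −c·Λ⟨((Φ−1)G,u)⟩ − ν·Λ⟨(u,Δ(ΨG))⟩`, so C⁺ ⇔ `GridThesis` modulo that
provable-now support item and a tail shift (see `WorkSplitTransfer`, `WorkSplitOfGridThesis`). -/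
def WorkSplitThesis : Prop :=
  ∃ (Φ Ψ : 𝕋³ → ℝ) (G : 𝕋³ → E³) (c η'' : ℝ) (Λ : Literature.Analysis.FluidPDE.GeneralizedLimit),
    IsGridDesign Φ Ψ G c ∧ 0 < η'' ∧
    ∃ (ν : ℕ → ℝ) (u₀ : ℕ → 𝕋³ → E³) (u : ℕ → ℝ → 𝕋³ → E³),
      IsBoundedNoLeakFamily Φ G c ν u₀ u ∧
      (∀ j, 0 ≤ Λ.longTimeAvg (fun t => ∫ x, inner ℝ (G x) (u j t x))) ∧
      (∀ j, η'' ≤ Λ.longTimeAvg (fun t => ∫ x, inner ℝ ((Φ x - 1) • G x) (u j t x)))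

/-- The one analytic input of the transfer besides `GridInjectionIdentity`: the viscous pairing
`Λ⟨(u, ΔZ)⟩` of a global Leray–Hopf solution with sup-bounded energy against a smooth steady field
is bounded by `‖ΔZ‖_∞ (1 + meanEnergy u)/2` (pointwise `‖v‖ ≤ (1+‖v‖²)/2`, Cesàro means, and the
sandwich `GeneralizedLimit.le_limsup`). Provable now (it is also a step of the route's Assembly
item stmt-1776). -/
def LaplacianPairingBound : Prop :=
  ∀ (Λ : Literature.Analysis.FluidPDE.GeneralizedLimit) (ν M : ℝ) (f Z u₀ : 𝕋³ → E³) (u : ℝ → 𝕋³ → E³),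
    0 < ν → Literature.Analysis.FunctionSpaces.Torus.IsSmooth f →
    Literature.Analysis.FunctionSpaces.Torus.IsSmooth Z →
    (∀ x, ‖Literature.Analysis.FunctionSpaces.Torus.laplacian Z x‖ ≤ M) →
    Literature.Analysis.FluidPDE.Torus.IsGlobalLerayHopf ν (fun _ => f) u₀ u →
    (∃ C : ℝ, ∀ t : ℝ, 0 ≤ t → Literature.Analysis.FunctionSpaces.Torus.kineticEnergy (u t) ≤ C) →
    |Λ.longTimeAvg (fun t => ∫ x, inner ℝ (u t x) (Literature.Analysis.FunctionSpaces.Torus.laplacian Z x))| ≤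
      M * (1 + Literature.Analysis.FluidPDE.meanEnergy u) / 2

/-- **First lemma of card `ac-dc-eddy-drag` (forward transfer).** C⁺ ⇒ crux, given the route's
provable-now identity and the pairing bound: for each `j`, (b) with `η := c·η″/2` holds as soon
as `νⱼ‖Δ(ΨG)‖_∞(1+E)/2 ≤ c·η″/2`, i.e. for `j ≥ J`; reindex the family by `j ↦ j + J`
(`Filter.tendsto_add_atTop_iff_nat`). Real-analysis core proved below
(`eventually_signs_of_workSplit`); the rest is additivity of `Λ.longTimeAvg`
(`GeneralizedLimit.longTimeAvg_add/const_mul`, in tree) on the bounded measurable integrands. -/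
def WorkSplitTransfer : Prop :=
  GridInjectionIdentity → LaplacianPairingBound → WorkSplitThesis → GridThesis

/-- The converse direction (crux ⇒ C⁺, with `η″ := η/(2c)` after the same tail shift), so that
C⁺ is an EQUIVALENT form of the crux modulo `GridInjectionIdentity`. -/
def WorkSplitOfGridThesis : Prop :=
  GridInjectionIdentity → LaplacianPairingBound → GridThesis → WorkSplitThesis

/-- **Proved core of `WorkSplitTransfer`.** Abstractly: if `Bⱼ = c·DCⱼ − c·(DCⱼ + ACⱼ) − νⱼRⱼ`
(the identity, `DCⱼ + ACⱼ` = injection), `|Rⱼ| ≤ K`, `ACⱼ ≥ η″ > 0` and `νⱼ → 0`, then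
eventually `Bⱼ ≤ −c·η″/2`, i.e. clause (b) with `η = c·η″/2`. -/
theorem eventually_signs_of_workSplit {c η'' K : ℝ} (hc : 0 < c) (hη : 0 < η'')
    {ν DC AC B R : ℕ → ℝ} (hν : Tendsto ν atTop (nhds 0))
    (hid : ∀ j, B j = c * DC j - c * (DC j + AC j) - ν j * R j)
    (hR : ∀ j, |R j| ≤ K) (hAC : ∀ j, η'' ≤ AC j) :
    ∃ J : ℕ, ∀ j, J ≤ j → B j ≤ -(c * η'' / 2) := by
  have hK : 0 ≤ K := le_trans (abs_nonneg _) (hR 0)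
  have hε : 0 < c * η'' / (2 * (K + 1)) := by positivity
  obtain ⟨J, hJ⟩ := Metric.tendsto_atTop.mp hν _ hε
  refine ⟨J, fun j hj => ?_⟩
  have h1 : |ν j| < c * η'' / (2 * (K + 1)) := by
    have := hJ j hj
    simpa [Real.dist_eq] using this
  have h2 : |ν j * R j| ≤ c * η'' / 2 := by
    rw [abs_mul]
    have hK1 : 0 < K + 1 := by linarith
    calc |ν j| * |R j| ≤ (c * η'' / (2 * (K + 1))) * K :=
          mul_le_mul h1.le (hR j) (abs_nonneg _) hε.le
      _ ≤ (c * η'' / (2 * (K + 1))) * (K + 1) :=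
          mul_le_mul_of_nonneg_left (by linarith) hε.le
      _ = c * η'' / 2 := by field_simp
  have h3 : -(ν j * R j) ≤ c * η'' / 2 := le_trans (neg_le_abs _) h2
  have h4 : B j = -(c * AC j) - ν j * R j := by rw [hid j]; ring
  have h5 : c * η'' ≤ c * AC j := mul_le_mul_of_nonneg_left (hAC j) hc.le
  rw [h4]
  linarith

/-- **Exact modal balance (F2; the "α-balance").** For ANY steady smooth force `f`, any smooth
divergence-free Stokes eigenfield pattern `G` (`ΔG = −λG`), any global Leray–Hopf solution with
sup-bounded energy and any Banach mean `Λ`: the pattern amplitude `a(t) = (G,u(t))` is Lipschitz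
with `ȧ = T_G(u) − νλ·a + (f,G)`, `T_G(u) := ∫⟪u,(u·∇)G⟫` (weak form tested with `G`, as in the
route's `MeanMomentumBalance`), hence `Λ⟨d/dt(a²/2)⟩ = 0` gives
`(f,G)·Λ⟨a⟩ = νλ·Λ⟨a²⟩ − Λ⟨a·T_G(u)⟩`.
Consequence (DC eddy drag): if `(f,G) > 0` and `Λ⟨a·T_G⟩ ≤ 0` then `Λ⟨a⟩ ≥ 0` — clause (a).
Applied to the quadrature pair `C = cos(2πx₀)G`, `S = sin(2πx₀)G` (eigenvalue `λ + 4π²`) and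
summed, the Doppler rotation `∓2πc` cancels and one gets the AC balance
`(f,C)Λ⟨X⟩ + (f,S)Λ⟨Y⟩ = ν(λ+4π²)Λ⟨X²+Y²⟩ − Λ⟨X·T_C + Y·T_S⟩`. Provable now (M). -/
def AlphaBalance : Prop :=
  ∀ (Λ : Literature.Analysis.FluidPDE.GeneralizedLimit) (ν lam : ℝ) (f G u₀ : 𝕋³ → E³) (u : ℝ → 𝕋³ → E³),
    0 < ν → Literature.Analysis.FunctionSpaces.Torus.IsSmooth f →
    Literature.Analysis.FunctionSpaces.Torus.IsSmooth G →
    Literature.Analysis.FunctionSpaces.Torus.IsDivFree G →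
    (∀ x, Literature.Analysis.FunctionSpaces.Torus.laplacian G x = -(lam • G x)) →
    Literature.Analysis.FluidPDE.Torus.IsGlobalLerayHopf ν (fun _ => f) u₀ u →
    (∃ C : ℝ, ∀ t : ℝ, 0 ≤ t → Literature.Analysis.FunctionSpaces.Torus.kineticEnergy (u t) ≤ C) →
    (∫ x, inner ℝ (f x) (G x)) * Λ.longTimeAvg (fun t => ∫ x, inner ℝ (G x) (u t x)) =
      ν * lam * Λ.longTimeAvg (fun t => (∫ x, inner ℝ (G x) (u t x)) ^ 2) -
        Λ.longTimeAvg (fun t => (∫ x, inner ℝ (G x) (u t x)) *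
          ∫ x, inner ℝ (u t x) (Literature.Analysis.FunctionSpaces.Torus.convect (u t) G x))

/-- The streamwise characters `cos(2πx₀)`, `sin(2πx₀)` on `T³` (real/imaginary parts of Mathlib's
Fourier monomial, as in the tree's `Torus.stokesMode`). -/
def cosX0 (x : 𝕋³) : ℝ := (UnitAddTorus.mFourier (Pi.single (0 : Fin 3) (1 : ℤ)) x).re

/-- See `cosX0`. -/
def sinX0 (x : 𝕋³) : ℝ := (UnitAddTorus.mFourier (Pi.single (0 : Fin 3) (1 : ℤ)) x).im

/-- **C⁺⁺ (eddy-drag thesis) for the MINIMAL AC/DC grid**: one streamwise harmonic,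
`Φ = 1 + 2θ cos(2πx₀)`, `Ψ = (θ/π) sin(2πx₀)`, and a transverse Stokes-eigen steady-Euler
pattern `G` (cellular). A BE+NL drift family such that, in one Banach mean, the turbulent
transfer is a DRAG on each forced mode: (DC) `Λ⟨a·T_G(u)⟩ ≤ 0` and (AC)
`Λ⟨X·T_C(u) + Y·T_S(u)⟩ ≤ −δ < 0`, where `a = (G,u)`, `X = (cos(2πx₀)G, u)`,
`Y = (sin(2πx₀)G, u)`, `T_P(u) = ∫⟪u,(u·∇)P⟫`. By `AlphaBalance`, (DC) ⇒ clause (a) and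
(AC) ⇒ AC work `2θΛ⟨X⟩ ≥ 2δ/‖G‖²`, hence C⁺ and the crux (`EddyDragTransfer`). -/
def EddyDragThesis : Prop :=
  ∃ (G : 𝕋³ → E³) (c θ lam δ : ℝ) (Λ : Literature.Analysis.FluidPDE.GeneralizedLimit),
    IsGridDesign (fun x => 1 + 2 * θ * cosX0 x) (fun x => θ / Real.pi * sinX0 x) G c ∧ 0 < θ ∧ 0 < δ ∧
    (∀ x, Literature.Analysis.FunctionSpaces.Torus.laplacian G x = -(lam • G x)) ∧
    (∃ q : 𝕋³ → ℝ, Literature.Analysis.FunctionSpaces.Torus.IsSmooth q ∧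
      ∀ x, Literature.Analysis.FunctionSpaces.Torus.convect G G x =
        Literature.Analysis.FunctionSpaces.Torus.gradient q x) ∧
    ∃ (ν : ℕ → ℝ) (u₀ : ℕ → 𝕋³ → E³) (u : ℕ → ℝ → 𝕋³ → E³),
      IsBoundedNoLeakFamily (fun x => 1 + 2 * θ * cosX0 x) G c ν u₀ u ∧
      (∀ j, Λ.longTimeAvg (fun t => (∫ x, inner ℝ (G x) (u j t x)) *
          ∫ x, inner ℝ (u j t x) (Literature.Analysis.FunctionSpaces.Torus.convect (u j t) G x)) ≤ 0) ∧
      (∀ j, Λ.longTimeAvg (fun t =>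
          (∫ x, inner ℝ (cosX0 x • G x) (u j t x)) *
            (∫ x, inner ℝ (u j t x)
              (Literature.Analysis.FunctionSpaces.Torus.convect (u j t) (fun y => cosX0 y • G y) x)) +
          (∫ x, inner ℝ (sinX0 x • G x) (u j t x)) *
            (∫ x, inner ℝ (u j t x)
              (Literature.Analysis.FunctionSpaces.Torus.convect (u j t) (fun y => sinX0 y • G y) x))) ≤ -δ)

/-- C⁺⁺ ⇒ crux, through C⁺: the two eddy-drag inequalities give (DC ≥ 0, AC ≥ 2δ/‖G‖²) by
`AlphaBalance` (the viscous terms `νλΛ⟨a²⟩`, `νλ₁Λ⟨X²+Y²⟩` are non-negative), then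
`WorkSplitTransfer`. -/
def EddyDragTransfer : Prop :=
  GridInjectionIdentity → LaplacianPairingBound → AlphaBalance → EddyDragThesis → GridThesis

/-! ### Card `no-reversal-half-space` — clause (a) as a forward-invariant half-space -/

/-- **First lemma of card `no-reversal-half-space` (barrier form).** Steady smooth force `f`,
smooth divergence-free Stokes eigenfield `G` with `(f,G) > 0`, global Leray–Hopf `u` with
sup-bounded energy. If the pattern amplitude starts non-negative, `(G,u₀) ≥ 0`, and the transfer
never undershoots the input while the amplitude is non-positive —
`(G,u(t)) ≤ 0 ⇒ T_G(u(t)) ≥ −(f,G)` — then `(G,u(t)) ≥ 0` for all `t ≥ 0` (on `{a < 0}` one has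
`ȧ = T_G − νλa + (f,G) ≥ 0`; `a` is continuous by weak continuity). In particular every Banach
mean gives clause (a). Abstract core proved below (`nonneg_of_barrier`). -/
def NoReversalBarrier : Prop :=
  ∀ (ν lam : ℝ) (f G u₀ : 𝕋³ → E³) (u : ℝ → 𝕋³ → E³),
    0 < ν → 0 < lam → Literature.Analysis.FunctionSpaces.Torus.IsSmooth f →
    Literature.Analysis.FunctionSpaces.Torus.IsSmooth G →
    Literature.Analysis.FunctionSpaces.Torus.IsDivFree G →
    (∀ x, Literature.Analysis.FunctionSpaces.Torus.laplacian G x = -(lam • G x)) →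
    0 < ∫ x, inner ℝ (f x) (G x) →
    Literature.Analysis.FluidPDE.Torus.IsGlobalLerayHopf ν (fun _ => f) u₀ u →
    (∃ C : ℝ, ∀ t : ℝ, 0 ≤ t → Literature.Analysis.FunctionSpaces.Torus.kineticEnergy (u t) ≤ C) →
    0 ≤ ∫ x, inner ℝ (G x) (u₀ x) →
    (∀ t : ℝ, 0 ≤ t → ∫ x, inner ℝ (G x) (u t x) ≤ 0 →
      -(∫ x, inner ℝ (f x) (G x)) ≤
        ∫ x, inner ℝ (u t x) (Literature.Analysis.FunctionSpaces.Torus.convect (u t) G x)) →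
    ∀ t : ℝ, 0 ≤ t → 0 ≤ ∫ x, inner ℝ (G x) (u t x)

/-- **Energy-threshold form (the card's physical statement).** For a GRID pattern (`G`
x₀-independent, `G ⊥ e₀`, divergence free, Stokes-eigen, steady-Euler: `(G·∇)G = ∇q`) with
pointwise strain bound `|⟪ξ,(ξ·∇)G⟫| ≤ σ|ξ|²`, the transfer of a drift-`c` solution reduces
EXACTLY to fluctuation production, `T_G(u) = ∫⟪w′,(w′·∇)G⟫ ≥ −σ‖w′‖² ≥ −σ(2·KE(u) − c²)`
(`w′ = u_⊥ − (a/‖G‖²)G`; the cross terms vanish because `∫(∂₀u₀)h(x_⊥) = 0`; `∫u₀² ≥ c²` by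
Jensen and momentum conservation). Hence: if the wake is SUB-THRESHOLD at the pattern's
non-positive set — `σ(2·KE(u(t)) − c²) ≤ (f,G)` whenever `(G,u(t)) ≤ 0` — the amplitude never
reverses. Threshold energy `(f,G)/(2σ) ≈ |G|M/2` vs kick energy `|G|²/(2c²)`: ratio `M/I`. -/
def NoReversalOfSubthresholdWake : Prop :=
  ∀ (ν lam σ c : ℝ) (Φ : 𝕋³ → ℝ) (G u₀ : 𝕋³ → E³) (u : ℝ → 𝕋³ → E³),
    0 < ν → 0 < lam → 0 ≤ σ → 0 < c →
    Literature.Analysis.FunctionSpaces.Torus.IsSmooth Φ →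
    Literature.Analysis.FunctionSpaces.Torus.IsSmooth G →
    (∀ (s : UnitAddCircle) x, G (x + Pi.single (0 : Fin 3) s) = G x) → (∀ x, G x 0 = 0) →
    Literature.Analysis.FunctionSpaces.Torus.IsDivFree G →
    (∀ x, Literature.Analysis.FunctionSpaces.Torus.laplacian G x = -(lam • G x)) →
    (∃ q : 𝕋³ → ℝ, Literature.Analysis.FunctionSpaces.Torus.IsSmooth q ∧
      ∀ x, Literature.Analysis.FunctionSpaces.Torus.convect G G x =
        Literature.Analysis.FunctionSpaces.Torus.gradient q x) →
    (∀ x (ξ : E³), |inner ℝ ξ (Literature.Analysis.FunctionSpaces.Torus.convect (fun _ => ξ) G x)| ≤ σ * ‖ξ‖ ^ 2) →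
    Literature.Analysis.FunctionSpaces.Torus.IsSmooth (fun x => Φ x • G x) →
    Literature.Analysis.FunctionSpaces.Torus.IsDivFree (fun x => Φ x • G x) →
    Literature.Analysis.FunctionSpaces.Torus.HasZeroMean (fun x => Φ x • G x) →
    0 < ∫ x, inner ℝ (Φ x • G x) (G x) →
    Literature.Analysis.FluidPDE.Torus.IsGlobalLerayHopf ν (fun _ => fun x => Φ x • G x) u₀ u →
    (∃ C : ℝ, ∀ t : ℝ, 0 ≤ t → Literature.Analysis.FunctionSpaces.Torus.kineticEnergy (u t) ≤ C) →
    (∫ x, u₀ x = c • EuclideanSpace.single (0 : Fin 3) (1 : ℝ)) →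
    0 ≤ ∫ x, inner ℝ (G x) (u₀ x) →
    (∀ t : ℝ, 0 ≤ t → ∫ x, inner ℝ (G x) (u t x) ≤ 0 →
      σ * (2 * Literature.Analysis.FunctionSpaces.Torus.kineticEnergy (u t) - c ^ 2) ≤
        ∫ x, inner ℝ (Φ x • G x) (G x)) →
    ∀ t : ℝ, 0 ≤ t → 0 ≤ ∫ x, inner ℝ (G x) (u t x)

/-- **C⁺ of card `no-reversal-half-space` (sub-threshold wake thesis).** `GridThesis` with clause
(a) REPLACED by: a Stokes-eigen steady-Euler pattern with strain bound `σ`, aligned data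
`(G,u₀ⱼ) ≥ 0`, and the conditional instantaneous energy inequality
`σ(2·KE(uⱼ(t)) − c²) ≤ ∫Φ|G|²` at every time where `(G,uⱼ(t)) ≤ 0` (vacuous if the imprint never
crosses zero). By `NoReversalOfSubthresholdWake`, `(G,uⱼ(t)) ≥ 0` for all `t ≥ 0`, hence clause (a)
in EVERY Banach mean (`GeneralizedLimit.longTimeAvg_nonneg`); the other clauses are copied. -/
def SubthresholdWakeThesis : Prop :=
  ∃ (Φ Ψ : 𝕋³ → ℝ) (G : 𝕋³ → E³) (c η lam σ : ℝ) (Λ : Literature.Analysis.FluidPDE.GeneralizedLimit),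
    IsGridDesign Φ Ψ G c ∧ 0 < η ∧ 0 < lam ∧ 0 ≤ σ ∧
    (∀ x, Literature.Analysis.FunctionSpaces.Torus.laplacian G x = -(lam • G x)) ∧
    (∃ q : 𝕋³ → ℝ, Literature.Analysis.FunctionSpaces.Torus.IsSmooth q ∧
      ∀ x, Literature.Analysis.FunctionSpaces.Torus.convect G G x =
        Literature.Analysis.FunctionSpaces.Torus.gradient q x) ∧
    (∀ x (ξ : E³), |inner ℝ ξ (Literature.Analysis.FunctionSpaces.Torus.convect (fun _ => ξ) G x)| ≤ σ * ‖ξ‖ ^ 2) ∧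
    0 < (∫ x, inner ℝ (Φ x • G x) (G x)) ∧
    ∃ (ν : ℕ → ℝ) (u₀ : ℕ → 𝕋³ → E³) (u : ℕ → ℝ → 𝕋³ → E³),
      IsBoundedNoLeakFamily Φ G c ν u₀ u ∧
      (∀ j, 0 ≤ ∫ x, inner ℝ (G x) (u₀ j x)) ∧
      (∀ j (t : ℝ), 0 ≤ t → ∫ x, inner ℝ (G x) (u j t x) ≤ 0 →
        σ * (2 * Literature.Analysis.FunctionSpaces.Torus.kineticEnergy (u j t) - c ^ 2) ≤
          ∫ x, inner ℝ (Φ x • G x) (G x)) ∧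
      (∀ j, Λ.longTimeAvg (fun t => ∫ x, inner ℝ (u j t x - c • EuclideanSpace.single 0 1)
          (Literature.Analysis.FunctionSpaces.Torus.convect (fun y => u j t y - c • EuclideanSpace.single 0 1)
            (fun y => Ψ y • G y) x)) ≤ -η)

/-- **First lemma of card `no-reversal-half-space` (transfer).** The sub-threshold wake thesis
implies the crux: `NoReversalOfSubthresholdWake` gives `(G,uⱼ(t)) ≥ 0` pointwise, and a
non-negative function bounded by the sup-energy has non-negative Banach mean. -/
def SubthresholdTransfer : Prop :=
  NoReversalOfSubthresholdWake → SubthresholdWakeThesis → GridThesis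

/-- **Proved abstract core of the barrier lemma.** A continuous `a : ℝ → ℝ` with `a 0 ≥ 0` which
is non-decreasing on every interval on which it is negative (`a < 0` on `[s,t]` ⇒ `a s ≤ a t`)
stays non-negative on `[0,∞)`. (In `NoReversalBarrier` the monotonicity on `{a < 0}` comes from
`a t − a s = ∫ₛᵗ ȧ` with `ȧ ≥ 0` there.) -/
theorem nonneg_of_barrier {a : ℝ → ℝ} (ha : Continuous a) (h0 : 0 ≤ a 0)
    (hmono : ∀ s t : ℝ, 0 ≤ s → s ≤ t → (∀ τ ∈ Icc s t, a τ < 0) → a s ≤ a t) :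
    ∀ t : ℝ, 0 ≤ t → 0 ≤ a t := by
  intro t ht
  by_contra hneg
  push Not at hneg
  -- the set of good times before `t`
  set A : Set ℝ := {s | s ∈ Icc 0 t ∧ 0 ≤ a s} with hA
  have hA0 : (0 : ℝ) ∈ A := ⟨⟨le_rfl, ht⟩, h0⟩
  have hAne : A.Nonempty := ⟨0, hA0⟩
  have hAbdd : BddAbove A := ⟨t, fun s hs => hs.1.2⟩
  set s₀ := sSup A with hs₀
  have hs₀_le : s₀ ≤ t := csSup_le hAne fun s hs => hs.1.2
  have hs₀_ge : 0 ≤ s₀ := le_csSup hAbdd hA0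
  -- `A` is closed, so `s₀ ∈ A`
  have hAclosed : IsClosed A := by
    have : A = Icc 0 t ∩ a ⁻¹' Ici 0 := by
      ext s; simp [hA, Set.mem_Ici]
    rw [this]
    exact isClosed_Icc.inter (isClosed_Ici.preimage ha)
  have hs₀A : s₀ ∈ A := hAclosed.csSup_mem hAne hAbdd
  have has₀ : 0 ≤ a s₀ := hs₀A.2
  -- `s₀ < t` since `a t < 0`
  have hs₀_lt : s₀ < t := lt_of_le_of_ne hs₀_le (fun h => by rw [h] at has₀; linarith)
  -- on `(s₀, t]` the function is negative
  have hneg' : ∀ τ, s₀ < τ → τ ≤ t → a τ < 0 := by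
    intro τ h1 h2
    by_contra hτ
    push Not at hτ
    have hτA : τ ∈ A := ⟨⟨le_trans hs₀_ge h1.le, h2⟩, hτ⟩
    have : τ ≤ s₀ := le_csSup hAbdd hτA
    linarith
  -- by continuity at `s₀`, `a s₀ ≤ 0`... in fact we derive a contradiction via an intermediate point:
  -- pick `τ₁ ∈ (s₀, t]`; on `[τ₁, t]` we have `a < 0`, so `a τ₁ ≤ a t < 0`; letting `τ₁ ↓ s₀`,
  -- continuity gives `a s₀ ≤ a t < 0`, contradicting `0 ≤ a s₀`.
  have hlim : Tendsto a (nhdsWithin s₀ (Ioc s₀ t)) (nhds (a s₀)) :=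
    (ha.tendsto s₀).mono_left nhdsWithin_le_nhds
  have hev : ∀ᶠ τ in nhdsWithin s₀ (Ioc s₀ t), a τ ≤ a t := by
    refine eventually_nhdsWithin_of_forall fun τ hτ => ?_
    exact hmono τ t (le_trans hs₀_ge hτ.1.le) hτ.2 fun σ hσ => hneg' σ (lt_of_lt_of_le hτ.1 hσ.1) hσ.2
  have hne : (nhdsWithin s₀ (Ioc s₀ t)).NeBot := by
    rw [← mem_closure_iff_nhdsWithin_neBot, closure_Ioc hs₀_lt.ne]
    exact ⟨le_rfl, hs₀_le⟩
  have : a s₀ ≤ a t := le_of_tendsto hlim hev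
  linarith

end

end Summit.AnomalousDissipation.AnomalousDissipation.Cruxes.GridThesis.Ideator2
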